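import Summits.Parity.GeneralizedHardyLittlewood.Theses.LeeYangFibres
import Summits.Parity.GeneralizedHardyLittlewood.Theorems.LeeYangFibresCellParityLawConditional
import Summits.Parity.GeneralizedHardyLittlewood.Theorems.LeeYangFibresCellParityLawP2Defs
import Summits.Parity.GeneralizedHardyLittlewood.Theorems.LeeYangFibresCellParityLawPrimeUpperBound
import Summits.Parity.GeneralizedHardyLittlewood.Theorems.LeeYangFibresCellParityLawRecursionIdentity
import Summits.Parity.GeneralizedHardyLittlewood.Theorems.LeeYangFibresCellParityLawFibreInheritance
import Summits.Parity.GeneralizedHardyLittlewood.Theorems.LeeYangFibresCellParityLawModelPrimeSum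
import Summits.Parity.GeneralizedHardyLittlewood.Theorems.LeeYangFibresCellParityLawCoveringInequality
import Summits.Parity.GeneralizedHardyLittlewood.Theorems.LeeYangFibresCellParityLawGeThreeReduceStrong
import Summits.Parity.GeneralizedHardyLittlewood.Theorems.LeeYangFibresCellParityLawInductionDefs
import Summits.Parity.GeneralizedHardyLittlewood.Theorems.LeeYangFibresCellParityLawInductionBaseOne
import Summits.Parity.GeneralizedHardyLittlewood.Theorems.LeeYangFibresCellParityLawInductionBaseTwo
import Summits.Parity.GeneralizedHardyLittlewood.Theorems.LeeYangFibresCellParityLawInductionPackage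
import Summits.Parity.GeneralizedHardyLittlewood.Theorems.LeeYangFibresCellParityLawInductionStep
import HarnessLib

/-!
# Route `LeeYangFibres`, crux `CellParityLaw` (stmt-Parity-14109), line `section-annihilator`:
# the conditional closure of the crux along skeleton v20 — `CellParityLaw` from the atom and the `P₂` kernel

CONDITIONAL RESULT (lead c6, 2026-08-16). Skeleton v20 of the line (`Cruxes/CellParityLaw/Lines/section_annihilator.lean`)
has `sorry` in exactly two registered statements, neither provable by design:

* (A) the ATOM `∀ t ≥ 1, SectionLevelAt t` — typed tuple-GEH for the section sequences at level `N^{1−(log log N)^{−B}}`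
  (`Theorems/LeeYangFibresCellParityLawDefs.lean`; a conjecture, ≥ EH already at `t = 1`);
* (K) the KERNEL `EffectiveWeightedP2Law` — Bombieri's `P₂` law ([BombieriRIMS1977] p. 5, `r = 2`) for the Buchstab
  test functions, EFFECTIVE with a polynomial rate in the level deficit and UNIFORM over the admissible class
  (`Theorems/LeeYangFibresCellParityLawP2Defs.lean`; unpublished research — printed proofs are qualitative).

This file records the line's endpoint as ONE kernel-checked implication `(A) → (K) → CellParityLaw`
(`stub_conditionalClosureP2`, registered bookkeeping stub), composing only LANDED theorems: the induction
`KernelInduction` (InductionDefs p127248, BaseOne p127406, BaseTwo p127443, Package p127444, Step p128407 with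
SumRestrict p127642 / FibreRanges p127676 / StepBudget p127795), its four inputs (PrimeUpperBound p123084,
RecursionIdentity p122589, FibreInheritance p124156, ModelPrimeSum p125471), the strong reduction
(CoveringInequality p125802, GeThreeReduceStrong p126342, bookkeeping `stub_geThreeComposeStrong` p122038), the glue of
the `u ≥ 3` rung (c2), the `u = 2` rung, Euler ratio, case split and conversion (c1), and the reduction of the crux to
the atom and the engine (c0–c2, `cellParityLaw_of_atom_of_engine`). It supersedes c2's
`cellParityLaw_of_atom_of_kernel` (p118217), whose kernel was the former all-cells law `EffectiveRoughCellLaw`.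

References: E. Bombieri, RIMS Kôkyûroku 294 (1977) p. 5 [BombieriRIMS1977]; E. Bombieri, Rend. Accad. Naz. XL (5)
1/2 (1975/76) [BombieriAsymptoticSieve1976]; J. Friedlander, H. Iwaniec, Ann. Sc. Norm. Sup. Pisa (4) 5 (1978) §4
[FriedlanderIwaniecPisa1978].
-/

noncomputable section

open scoped BigOperators Classical
open Finset Filter Literature.NumberTheory.Sieve

namespace Summit.Parity.GeneralizedHardyLittlewood.Cruxes.CellParityLaw.SectionAnnihilator

/-- **`KernelInduction` holds** (lead c6): composed from its four landed pieces by the landed bookkeeping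
`stub_kernelInductionPieces`. -/
theorem kernelInduction_holds : KernelInduction :=
  stub_kernelInductionPieces stub_inductionBaseOne stub_inductionBaseTwo stub_inductionStep stub_inductionPackage

/-- **The strong rough-cell law from the `P₂` kernel**: `EffectiveWeightedP2Law → EffectiveRoughCellLawStrong`, by the
landed induction and its four landed inputs. -/
theorem effectiveRoughCellLawStrong_of_P2 (hK : EffectiveWeightedP2Law) : EffectiveRoughCellLawStrong :=
  kernelInduction_holds stub_primeUpperBound stub_recursionIdentity stub_fibreInheritance stub_modelPrimeSum hK

/-- **The `u ≥ 3` rung from the `P₂` kernel**: for every `t ≥ 1`, the atom at `t` and the kernel give the `u ≥ 3` rung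
of Bombieri's `P_r` law for the sections (all glue landed). -/
theorem sectionPrLawGeThree_of_P2 (hK : EffectiveWeightedP2Law) :
    ∀ t : ℕ, 1 ≤ t → SectionLevelAt t → ∀ u : ℕ, 3 ≤ u → SectionPrLawAtU u t :=
  stub_geThreeComposeStrong stub_primeUpperBound stub_recursionIdentity stub_fibreInheritance stub_modelPrimeSum
    hK kernelInduction_holds stub_coveringInequality
    stub_sectionSeqBFacts stub_sectionSeqBCells stub_sectionDimension stub_sectionDimensionLow
    stub_sectionMertensLowerHead stub_sectionMertensTwo stub_modelDensityAlladi stub_prLawTwoPrep stub_eulerRatio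
    stub_geThreeHyp stub_geThreeReduceStrong stub_geThreeMainTerm stub_geThreeAssembly

/-- **The engine from the `P₂` kernel**: the one-parameter section law at every `t ≥ 1` under the atom at `t`. -/
theorem sectionLaw_of_P2 (hK : EffectiveWeightedP2Law) : ∀ t : ℕ, 1 ≤ t → SectionLevelAt t → SectionLawAt t :=
  stub_engineCompose stub_eulerRatio (stub_prLawCases sectionPrLawTwo_of_atom (sectionPrLawGeThree_of_P2 hK))
    stub_lawOfPrLaw

/-- **`stub_conditionalClosureP2`** (registered bookkeeping stub of stmt-Parity-14109, lead c6): the crux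
`CellParityLaw` from the atom `∀ t ≥ 1, SectionLevelAt t` and the kernel `EffectiveWeightedP2Law` ALONE — the
line `section-annihilator` at skeleton v20, every other piece a landed theorem. A CONDITIONAL result: neither
hypothesis is claimed. -/
theorem stub_conditionalClosureP2 :
    (∀ t : ℕ, 1 ≤ t → SectionLevelAt t) → EffectiveWeightedP2Law →
      Summit.Parity.GeneralizedHardyLittlewood.Theses.LeeYangFibres.CellParityLaw :=
  fun hA hK => cellParityLaw_of_atom_of_engine hA (sectionLaw_of_P2 hK)

end Summit.Parity.GeneralizedHardyLittlewood.Cruxes.CellParityLaw.SectionAnnihilator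

end
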